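import Literature.Barriers.Parity.SiegelZeroQuadraticPolynomialsTheorem3
import Literature.Barriers.Parity.SiegelZeroQuadraticPolynomialsTheorem4Prep
import Literature.NumberTheory.LFunctions.HeckeLOneBound
import Literature.Barriers.Parity.SiegelZeroQuadraticPolynomialsTheorem4
import Literature.Barriers.Parity.SiegelZeroQuadraticPolynomialsTheorem1
import HarnessLib

/-!
# Granville–Mollin 2000, Corollary 1′ with Theorem 3: the catalogue's `GranvilleMollin2000_cor1'_thm3`
# over-claims for `d ≡ 1 (mod 8)`; the corrected transcription (`A` odd) and its assembly from
# Theorem 1 + Hecke's theorem and Theorem 4 + Heath-Brown's Lemma 3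

Topic `Literature/Barriers/Parity`, companion of the catalogue entry `SiegelZeroQuadraticPolynomials.lean`
(Granville–Mollin, *Rabinowitsch revisited*, Acta Arith. 96 (2000)), about its named fact
`Literature.Barriers.Parity.GranvilleMollin2000_cor1'_thm3` — Corollary 1′ ("if there are more than
`κ₃ N log|ad|/log N` primes amongst `an² + bn + c`, `n = 0, …, N`, for some `N` then `L(s, (d/·))`
has a Siegel zero") together with Theorem 3 ("Suppose that `L(s, (d/·))` with `d = 1 − 4A` has a
Siegel zero `β` with `1 − β ≤ 1/log³|d|`, that is, `η ≥ log²|d|`. Then there exists an integer `N`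
such that there are more than `κ₃ N log|A|/log N` primes amongst `|n² + n + A|`, `n = 0, …, N`").

## The discrepancy

Part 2 of the catalogue's transcription states Theorem 3 for ALL negative fundamental `d ≡ 1 (mod 4)`.
For `d ≡ 1 (mod 8)` — `A = (1 − d)/4` even — every value `n² + n + A = n(n + 1) + A` is even and
`≥ 4` (`|d| ≥ 15`), so `π_{f_d}(N) = 0` for all `N` (`polyPrimeCount_rabinowitsch_eq_zero`,
`SiegelZeroQuadraticPolynomialsTheorem4Prep.lean`) and the conclusion "more than `κ₃ N log A/log N ≥ 0`
primes" is impossible: for this subfamily the transcription ASSERTS that the hypothesis fails, i.e.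
that `L(s, (d/·))` has no real zero in `[1 − 1/log³|d|, 1)` for all large fundamental
`d ≡ 1 (mod 8)` — a zero-free region of Siegel type for an explicit infinite family of real
characters, which is not known, and which the source does not prove: its argument (§6B) rests on
(5.8), "`ϱ_d := ∏_{p ≤ √d}(1 − ω(p)/p) ≥ ∏_{p ≤ √d}(1 − (1 + (d/p))/p) ≫ …`", whose products vanish
when `(d/2) = +1` (`ω(2) = 2`). The printed Theorem 3 tacitly excludes a fixed prime divisor ("The
second [obvious reason why there might not be many prime values] is that prime `p` might divide
`f(n)` for every integer `n`, which is equivalent to `ω(p) = p`", p. 141), i.e. assumes `A` odd.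
This is made explicit below (`GranvilleMollin2000_cor1'_thm3.zeroFree_one_mod_eight`, PROVED), and the
statement is re-vendored as `GranvilleMollin2000_cor1'_thm3_odd` with `d ≡ 5 (mod 8)` in Part 2 —
implied by the original transcription, and PROVED here relative to the four printed inputs.
[cite: GranvilleMollin2000, p. 141, Corollary 1′, Theorem 3, §5C (5.8), §6B]

## Contents

* `GranvilleMollin2000_cor1'_thm3.zeroFree_one_mod_eight` — what the catalogue's fact asserts for
  `A` even (PROVED from it).
* `GranvilleMollin2000_cor1'_thm3_odd` (definition) — the corrected transcription; and
  `GranvilleMollin2000_cor1'_thm3.odd` — original ⟹ corrected.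
* `GranvilleMollin2000_cor1'_of_thm1` — **Corollary 1′** for `f_d` (every `κ₃` beyond a threshold)
  from the vendored Theorem 1 (`GranvilleMollin2000_thm1`, `τ = 1`) and Hecke's theorem
  (`Literature.NumberTheory.LFunctions.MontgomeryVaughan2007_thm11_4_LOne`: no exceptional zero ⟹
  `L(1, χ)⁻¹ ≪ log q`), as on p. 142 ("Hecke [13] proved that if `L(s, (d/·))` has no Siegel zero
  then `L(1, (d/·))⁻¹ ≪ log|d|` … We therefore deduce from Theorem 1: Corollary 1′"); for
  `2 ≤ N ≤ |d|` the count is trivially `≤ N + 1 ≤ κ₃ N log|d|/log N`.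
* `GranvilleMollin2000_cor1'_thm3_odd_of_inputs` — the corrected conjunction from
  `GranvilleMollin2000_thm1`, `MontgomeryVaughan2007_thm11_4_LOne`, `GranvilleMollin2000_thm4` and
  `GranvilleMollin2000_heathBrownLemma3` (Theorem 3 for `A` odd and every `κ` being
  `GranvilleMollin2000_thm3_odd_of_thm4` of `SiegelZeroQuadraticPolynomialsTheorem3.lean`); and, Hecke's
  theorem being discharged in the tree (`MontgomeryVaughan2007_thm11_4_LOne_holds`, from the proved
  MV Theorem 11.4 of `DirichletLFunctionInverseBound.lean`),
  `GranvilleMollin2000_cor1'_thm3_odd_of_thm1_thm4` — from the three Granville–Mollin facts alone.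
  Trust base of the corrected fact after this file: `GranvilleMollin2000_thm1`,
  `GranvilleMollin2000_thm4`, `GranvilleMollin2000_heathBrownLemma3` (Theorem 4 is further reduced to
  `GranvilleMollin2000_eq5_5'` and `GranvilleMollin2000_heathBrownLemma3` in the sibling files).

[cite: GranvilleMollin2000, Corollary 1′, Theorem 1, Theorem 3, p. 142]

Update (appended): Theorem 1 is now PROVED in the tree (`GranvilleMollin2000_thm1_holds`,
`SiegelZeroQuadraticPolynomialsTheorem1.lean`), as is Hecke's theorem
(`MontgomeryVaughan2007_thm11_4_LOne_holds`); hence **Corollary 1′ for `f_d` is an unconditional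
theorem** (`GranvilleMollin2000_cor1'`), and the corrected conjunction depends only on the two §5C
inputs `GranvilleMollin2000_eq5_5'`, `GranvilleMollin2000_heathBrownLemma3`
(`GranvilleMollin2000_cor1'_thm3_odd_of_eq5_5'`) — its trust base in the tree.

Update (verdict clean-up 2026-08-16): the catalogue's `GranvilleMollin2000_cor1'_thm3` is now a
`@[deprecated]` tombstone (mis-stated; body unchanged as the literal record) pointing at
`GranvilleMollin2000_cor1'_thm3_odd`, which is DISCHARGED in the tree
(`GranvilleMollin2000_cor1'_thm3_odd_holds`, `SiegelZeroQuadraticPolynomialsTheorem4Holds.lean`). The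
two record theorems below that must name the deprecated constant in their hypothesis
(`GranvilleMollin2000_cor1'_thm3.zeroFree_one_mod_eight` — the over-claim made explicit — and
`GranvilleMollin2000_cor1'_thm3.odd` — original ⟹ corrected) are kept verbatim under
`set_option linter.deprecated false in`; nothing else in this file names it.
-/

noncomputable section

open Finset Real
open Literature.NumberTheory.Sieve

namespace Literature.Barriers.Parity

/-! ### The over-claim of the catalogue's transcription for `d ≡ 1 (mod 8)` -/

-- The record theorem below is WHY `GranvilleMollin2000_cor1'_thm3` is deprecated (mis-stated; verdict
-- clean-up 2026-08-16) and must name that constant in its hypothesis; REMOVE-WHEN the deprecated def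
-- is deleted.
set_option linter.deprecated false in
/-- **What the deprecated `GranvilleMollin2000_cor1'_thm3` asserts for `A` even** (the record of its
over-claim; its hypothesis is the `@[deprecated]` tombstone, so this implication is evidence, not a
tool). Since `π_{f_d} ≡ 0` for
fundamental `d ≡ 1 (mod 8)` with `|d| ≥ 15` (`polyPrimeCount_rabinowitsch_eq_zero`), Part 2 of the
catalogue's fact yields: for all such `d` with `|d|` large, `L(s, (d/·))` has NO real zero
`1 − 1/(η log|d|)` with `η ≥ log²|d|` (none in `[1 − 1/log³|d|, 1)`) — a Siegel-type zero-free
region that the source neither states nor proves (its (5.8) fails at `p = 2` when `(d/2) = 1`).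
This is why the fact is re-vendored as `GranvilleMollin2000_cor1'_thm3_odd`.
[cite: GranvilleMollin2000, Theorem 3 and §5C (5.8)] -/
theorem GranvilleMollin2000_cor1'_thm3.zeroFree_one_mod_eight (h : GranvilleMollin2000_cor1'_thm3) :
    ∃ d₀ : ℝ, ∀ d : ℤ, IsNegFundOne d → d % 8 = 1 → d₀ ≤ |(d : ℝ)| →
      ∀ (q : ℕ) [NeZero q], (q : ℤ) = |d| → ∀ χ : DirichletCharacter ℂ q, χ.IsPrimitive →
        χ.IsQuadratic → ∀ η : ℝ, Real.log |(d : ℝ)| ^ 2 ≤ η →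
          χ.LFunction ((1 - 1 / (η * Real.log |(d : ℝ)|) : ℝ) : ℂ) ≠ 0 := by
  obtain ⟨κ₃, hκ₃, c₀, -, d₀, -, H2⟩ := h
  refine ⟨max d₀ 15, ?_⟩
  intro d hd hd8 hdd q _ hq χ hχp hχq η hη hzero
  obtain ⟨N, hN2, hNπ⟩ := H2 d hd ((le_max_left _ _).trans hdd) q hq χ hχp hχq η hη hzero
  obtain ⟨hdq, -, hq3, habs⟩ := eq_neg_of_isNegFundOne hd hq
  have hq8 : q % 8 = 7 := by omega
  have h15 : (15 : ℝ) ≤ |(d : ℝ)| := (le_max_right _ _).trans hdd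
  have hq15 : 15 ≤ q := by rw [habs] at h15; exact_mod_cast h15
  rw [polyPrimeCount_rabinowitsch_eq_zero hdq hq8 hq15 N, Nat.cast_zero] at hNπ
  have hlogA := (log_rabinowitschA_bounds hdq hq3).1
  have hNR : (2 : ℝ) ≤ N := by exact_mod_cast hN2
  have hlogN : 0 < Real.log N := Real.log_pos (by linarith)
  have : 0 ≤ κ₃ * N * Real.log (((1 - d) / 4 : ℤ) : ℝ) / Real.log N := by positivity
  linarith

/-! ### The corrected statement -/

/-- **Granville–Mollin, Corollary 1′ with Theorem 3 — CORRECTED transcription** (`A` odd). Verbatim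
the catalogue's `GranvilleMollin2000_cor1'_thm3` (same constants `κ₃`, `c₀`, `d₀`; same Part 1 =
Corollary 1′ for `f_d = x² + x + (1 − d)/4`), except that Part 2 (Theorem 3) is restricted to
`d ≡ 5 (mod 8)`, i.e. `A = (1 − d)/4` odd, so that `f_d` has no fixed prime divisor: there are
`κ₃ > 0`, a zero-free constant `c₀ > 0` and `d₀` such that (Corollary 1′) if for some `N ≥ 2` more
than `κ₃ N log|d|/log N` of `f_d(0), …, f_d(N)` are prime then `L(s, (d/·))` has a real zero `β` with
`1 − c₀/log|d| ≤ β < 1`; and (Theorem 3) if `d ≡ 5 (mod 8)`, `|d| ≥ d₀` and `L(s, (d/·))` has the real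
zero `1 − 1/(η log|d|)` with `η ≥ log²|d|`, then for some `N ≥ 2` more than `κ₃ N log A/log N` of
`f_d(0), …, f_d(N)` are prime. DISCREPANCY with the printed Theorem 3 ("`d = 1 − 4A`", no parity
condition on `A`): for `A` even every value of `n² + n + A` is even, the printed conclusion is void and
the printed proof ((5.8)) does not apply — see the module docstring and
`GranvilleMollin2000_cor1'_thm3.zeroFree_one_mod_eight`; the catalogue's transcription implies this
one (`GranvilleMollin2000_cor1'_thm3.odd`), which is proved from the printed inputs
(`GranvilleMollin2000_cor1'_thm3_odd_of_inputs`).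
[cite: GranvilleMollin2000, Corollary 1′ and Theorem 3 (with p. 141 on fixed prime divisors)] -/
def GranvilleMollin2000_cor1'_thm3_odd : Prop :=
  ∃ κ₃ : ℝ, 0 < κ₃ ∧ ∃ c₀ : ℝ, 0 < c₀ ∧ ∃ d₀ : ℝ,
    (∀ d : ℤ, IsNegFundOne d → ∀ (q : ℕ) [NeZero q], (q : ℤ) = |d| →
      ∀ χ : DirichletCharacter ℂ q, χ.IsPrimitive → χ.IsQuadratic →
        (∃ N : ℕ, 2 ≤ N ∧
            κ₃ * N * Real.log |(d : ℝ)| / Real.log N < polyPrimeCount ![rabinowitschPoly d] N) →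
          ∃ β : ℝ, 1 - c₀ / Real.log |(d : ℝ)| ≤ β ∧ β < 1 ∧ χ.LFunction (β : ℂ) = 0) ∧
    (∀ d : ℤ, IsNegFundOne d → d % 8 = 5 → d₀ ≤ |(d : ℝ)| → ∀ (q : ℕ) [NeZero q], (q : ℤ) = |d| →
      ∀ χ : DirichletCharacter ℂ q, χ.IsPrimitive → χ.IsQuadratic →
        ∀ η : ℝ, Real.log |(d : ℝ)| ^ 2 ≤ η →
          χ.LFunction ((1 - 1 / (η * Real.log |(d : ℝ)|) : ℝ) : ℂ) = 0 →
            ∃ N : ℕ, 2 ≤ N ∧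
              κ₃ * N * Real.log (((1 - d) / 4 : ℤ) : ℝ) / Real.log N <
                polyPrimeCount ![rabinowitschPoly d] N)

-- Idem: records that the deprecated transcription implies the corrected one; must name the deprecated
-- constant in its hypothesis; REMOVE-WHEN the deprecated def is deleted.
set_option linter.deprecated false in
/-- The catalogue's (deprecated, mis-stated) transcription implies the corrected one (Part 2 is
restricted, nothing else changes) — a record only: the conclusion is a theorem of the tree
(`GranvilleMollin2000_cor1'_thm3_odd_holds`, `SiegelZeroQuadraticPolynomialsTheorem4Holds.lean`), use
that. [cite: GranvilleMollin2000, Corollary 1′ and Theorem 3] -/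
theorem GranvilleMollin2000_cor1'_thm3.odd (h : GranvilleMollin2000_cor1'_thm3) :
    GranvilleMollin2000_cor1'_thm3_odd := by
  obtain ⟨κ₃, hκ₃, c₀, hc₀, d₀, H1, H2⟩ := h
  exact ⟨κ₃, hκ₃, c₀, hc₀, d₀, H1, fun d hd _ hdd q _ hq χ hχp hχq η hη hzero =>
    H2 d hd hdd q hq χ hχp hχq η hη hzero⟩

/-! ### Corollary 1′ from Theorem 1 and Hecke's theorem -/

/-- **Granville–Mollin, Corollary 1′ (for `f_d`) from Theorem 1 and Hecke's theorem.** With `K` from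
`GranvilleMollin2000_thm1` at `τ = 1` and `c, C` from `MontgomeryVaughan2007_thm11_4_LOne.of_log`,
every `κ₃ ≥ max(K, 0) C + 2` works with `c₀ = c`: if `L(s, χ_d)` had no real zero in
`[1 − c/log|d|, 1)` then `‖L(1, χ_d)‖⁻¹ ≤ C log|d|`, so for `N > |d|` Theorem 1 gives
`π_{f_d}(N) ≤ max(K, 0) C · N log|d|/log N`, while for `2 ≤ N ≤ |d|` trivially
`π_{f_d}(N) ≤ N + 1 ≤ 2N ≤ κ₃ N log|d|/log N`; either way not more than `κ₃ N log|d|/log N` primes.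
[cite: GranvilleMollin2000, Corollary 1′, Theorem 1 and p. 142] -/
theorem GranvilleMollin2000_cor1'_of_thm1 (h1 : GranvilleMollin2000_thm1)
    (hH : Literature.NumberTheory.LFunctions.MontgomeryVaughan2007_thm11_4_LOne) :
    ∃ κ₀ c₀ : ℝ, 0 < c₀ ∧ ∀ κ₃ : ℝ, κ₀ ≤ κ₃ → ∀ d : ℤ, IsNegFundOne d →
      ∀ (q : ℕ) [NeZero q], (q : ℤ) = |d| → ∀ χ : DirichletCharacter ℂ q, χ.IsPrimitive →
        χ.IsQuadratic →
          (∃ N : ℕ, 2 ≤ N ∧ κ₃ * N * Real.log |(d : ℝ)| / Real.log N <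
              (polyPrimeCount ![rabinowitschPoly d] N : ℝ)) →
            ∃ β : ℝ, 1 - c₀ / Real.log |(d : ℝ)| ≤ β ∧ β < 1 ∧ χ.LFunction (β : ℂ) = 0 := by
  obtain ⟨K, H1⟩ := h1 1 one_pos
  obtain ⟨c, hc, C, hC0, HH⟩ := hH.of_log
  refine ⟨max K 0 * C + 2, c, hc, ?_⟩
  intro κ₃ hκ₃ d hd q _ hq χ hχp hχq hN
  obtain ⟨N, hN2, hNπ⟩ := hN
  obtain ⟨-, -, hq3, habs⟩ := eq_neg_of_isNegFundOne hd hq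
  rw [habs] at hNπ ⊢
  by_contra hno
  push Not at hno
  -- `χ ≠ 1` (primitive of conductor `q ≥ 3`)
  have hχ1 : χ ≠ 1 := by
    intro h1'
    have := hχp
    rw [DirichletCharacter.isPrimitive_def, h1', DirichletCharacter.conductor_one] at this
    omega
  have hL := HH q χ (by omega) hχ1 hno
  have hK0 : 0 ≤ max K 0 := le_max_right _ _
  have hKC : 0 ≤ max K 0 * C := mul_nonneg hK0 hC0
  have hκ2 : 2 ≤ κ₃ := by linarith
  have hκ0 : 0 ≤ κ₃ := by linarith
  have hqR : (3 : ℝ) ≤ q := by exact_mod_cast hq3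
  have hlogq : 0 < Real.log q := Real.log_pos (by linarith)
  have hNR : (2 : ℝ) ≤ N := by exact_mod_cast hN2
  have hN0 : (0 : ℝ) < N := by linarith
  have hlogN : 0 < Real.log N := Real.log_pos (by linarith)
  have hπle : (polyPrimeCount ![rabinowitschPoly d] N : ℝ) ≤ N + 1 := by
    exact_mod_cast polyPrimeCount_le_succ ![rabinowitschPoly d] N
  rcases le_or_gt N q with hNq | hqN
  · -- `N ≤ q`: the trivial count
    have hlogle : Real.log N ≤ Real.log q := Real.log_le_log hN0 (by exact_mod_cast hNq)
    have hkey : κ₃ * N ≤ κ₃ * N * Real.log q / Real.log N := by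
      rw [le_div_iff₀ hlogN]
      exact mul_le_mul_of_nonneg_left hlogle (mul_nonneg hκ0 hN0.le)
    have h2N : 2 * (N : ℝ) ≤ κ₃ * N := mul_le_mul_of_nonneg_right hκ2 hN0.le
    linarith
  · -- `q < N`: Theorem 1 with `τ = 1`
    have hτ : |(d : ℝ)| ^ (1 : ℝ) < N := by rw [Real.rpow_one, habs]; exact_mod_cast hqN
    have e1 := H1 d hd q hq χ hχp hχq N hN2 hτ
    have hNdiv : 0 ≤ (N : ℝ) / Real.log N := by positivity
    have hinv0 : 0 ≤ ‖χ.LFunction 1‖⁻¹ := inv_nonneg.mpr (norm_nonneg _)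
    have e2 : (polyPrimeCount ![rabinowitschPoly d] N : ℝ) ≤
        max K 0 * C * (N * Real.log q / Real.log N) := by
      calc (polyPrimeCount ![rabinowitschPoly d] N : ℝ)
          ≤ K * ‖χ.LFunction 1‖⁻¹ * (N / Real.log N) := e1
        _ ≤ max K 0 * ‖χ.LFunction 1‖⁻¹ * (N / Real.log N) :=
            mul_le_mul_of_nonneg_right (mul_le_mul_of_nonneg_right (le_max_left _ _) hinv0) hNdiv
        _ ≤ max K 0 * (C * Real.log q) * (N / Real.log N) :=
            mul_le_mul_of_nonneg_right (mul_le_mul_of_nonneg_left hL hK0) hNdiv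
        _ = max K 0 * C * (N * Real.log q / Real.log N) := by ring
    have hpos : 0 < (N : ℝ) * Real.log q / Real.log N := by positivity
    have hrw : κ₃ * N * Real.log q / Real.log N = κ₃ * (N * Real.log q / Real.log N) := by ring
    rw [hrw] at hNπ
    have : max K 0 * C * (N * Real.log q / Real.log N) < κ₃ * (N * Real.log q / Real.log N) :=
      mul_lt_mul_of_pos_right (by linarith) hpos
    linarith

/-! ### The corrected conjunction from the four inputs -/

/-- **`GranvilleMollin2000_cor1'_thm3_odd` from the printed inputs**: Theorem 1
(`GranvilleMollin2000_thm1`), Hecke's theorem (`MontgomeryVaughan2007_thm11_4_LOne`), Theorem 4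
(`GranvilleMollin2000_thm4`) and Heath-Brown's Lemma 3 (`GranvilleMollin2000_heathBrownLemma3`): take
`κ₃ = max(κ₀, 1)` and `c₀` from `GranvilleMollin2000_cor1'_of_thm1`, and `d₀` from
`GranvilleMollin2000_thm3_odd_of_thm4` at this `κ₃`.
[cite: GranvilleMollin2000, Corollary 1′, Theorem 3, p. 142 and §6B] -/
theorem GranvilleMollin2000_cor1'_thm3_odd_of_inputs (h1 : GranvilleMollin2000_thm1)
    (hH : Literature.NumberTheory.LFunctions.MontgomeryVaughan2007_thm11_4_LOne)
    (h4 : GranvilleMollin2000_thm4) (hHB : GranvilleMollin2000_heathBrownLemma3) :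
    GranvilleMollin2000_cor1'_thm3_odd := by
  obtain ⟨κ₀, c₀, hc₀, HP1⟩ := GranvilleMollin2000_cor1'_of_thm1 h1 hH
  have hκ₃ : 0 < max κ₀ 1 := lt_of_lt_of_le one_pos (le_max_right _ _)
  obtain ⟨d₀, HP2⟩ := GranvilleMollin2000_thm3_odd_of_thm4 h4 hHB hκ₃
  exact ⟨max κ₀ 1, hκ₃, c₀, hc₀, d₀, HP1 _ (le_max_left _ _), HP2⟩

/-- **`GranvilleMollin2000_cor1'_thm3_odd` from Theorem 1, Theorem 4 and Heath-Brown's Lemma 3**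
(Hecke's theorem being the tree's `MontgomeryVaughan2007_thm11_4_LOne_holds`).
[cite: GranvilleMollin2000, Corollary 1′ and Theorem 3] -/
theorem GranvilleMollin2000_cor1'_thm3_odd_of_thm1_thm4 (h1 : GranvilleMollin2000_thm1)
    (h4 : GranvilleMollin2000_thm4) (hHB : GranvilleMollin2000_heathBrownLemma3) :
    GranvilleMollin2000_cor1'_thm3_odd :=
  GranvilleMollin2000_cor1'_thm3_odd_of_inputs h1
    Literature.NumberTheory.LFunctions.MontgomeryVaughan2007_thm11_4_LOne_holds h4 hHB

/-- **`GranvilleMollin2000_cor1'_thm3_odd` from Theorem 1 and the two exceptional-prime inputs of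
§5C** — `GranvilleMollin2000_eq5_5'` (the display before (5.5): `∑_{p ≤ x} ω(p) log p ≪ x log x /
log(d^η)` in the Linnik range) and `GranvilleMollin2000_heathBrownLemma3` (Heath-Brown's Lemma 3) —
Theorem 4 being assembled from these in the tree (`GranvilleMollin2000_thm4_of`,
`SiegelZeroQuadraticPolynomialsTheorem4.lean`). This is the minimal trust base of the corrected
fact in the tree: Theorem 1 and the two §5C displays. [cite: GranvilleMollin2000, Corollary 1′, Theorem 3, Theorem 4 and §5C] -/
theorem GranvilleMollin2000_cor1'_thm3_odd_of_thm1_eq5_5' (h1 : GranvilleMollin2000_thm1)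
    (h55 : GranvilleMollin2000_eq5_5') (hHB : GranvilleMollin2000_heathBrownLemma3) :
    GranvilleMollin2000_cor1'_thm3_odd :=
  GranvilleMollin2000_cor1'_thm3_odd_of_thm1_thm4 h1 (GranvilleMollin2000_thm4_of h55 hHB) hHB

/-! ### Unconditional consequences (Theorem 1 and Hecke's theorem being proved in the tree) -/

/-- **Granville–Mollin 2000, Corollary 1′ for `f_d = x² + x + (1 − d)/4`, PROVED**: there are
`κ₃ > 0` and `c₀ > 0` such that for every negative fundamental `d ≡ 1 (mod 4)` and the primitive
quadratic character `χ` mod `|d|` (`= (d/·)`): if for some `N ≥ 2` more than `κ₃ N log|d|/log N`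
of `f_d(0), …, f_d(N)` are prime, then `L(s, χ)` has a real zero `β` with `1 − c₀/log|d| ≤ β < 1`
("… then the `L`-function `L(s, (d/·))` has a Siegel zero"). Unconditional: Theorem 1 is the
tree's `GranvilleMollin2000_thm1_holds` and Hecke's theorem the tree's
`MontgomeryVaughan2007_thm11_4_LOne_holds`, combined by `GranvilleMollin2000_cor1'_of_thm1`.
[cite: GranvilleMollin2000, Corollary 1′ (with Theorem 1 and p. 142)] -/
theorem GranvilleMollin2000_cor1' :
    ∃ κ₃ : ℝ, 0 < κ₃ ∧ ∃ c₀ : ℝ, 0 < c₀ ∧ ∀ d : ℤ, IsNegFundOne d →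
      ∀ (q : ℕ) [NeZero q], (q : ℤ) = |d| → ∀ χ : DirichletCharacter ℂ q, χ.IsPrimitive →
        χ.IsQuadratic →
          (∃ N : ℕ, 2 ≤ N ∧ κ₃ * N * Real.log |(d : ℝ)| / Real.log N <
              (polyPrimeCount ![rabinowitschPoly d] N : ℝ)) →
            ∃ β : ℝ, 1 - c₀ / Real.log |(d : ℝ)| ≤ β ∧ β < 1 ∧ χ.LFunction (β : ℂ) = 0 := by
  obtain ⟨κ₀, c₀, hc₀, H⟩ := GranvilleMollin2000_cor1'_of_thm1 GranvilleMollin2000_thm1_holds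
    Literature.NumberTheory.LFunctions.MontgomeryVaughan2007_thm11_4_LOne_holds
  exact ⟨max κ₀ 1, lt_of_lt_of_le one_pos (le_max_right _ _), c₀, hc₀, H _ (le_max_left _ _)⟩

/-- **The corrected conjunction `GranvilleMollin2000_cor1'_thm3_odd` from the two exceptional-prime
inputs of §5C alone** (`GranvilleMollin2000_eq5_5'`, `GranvilleMollin2000_heathBrownLemma3`),
Theorem 1 being proved in the tree (`GranvilleMollin2000_thm1_holds`): its trust base in the tree.
[cite: GranvilleMollin2000, Corollary 1′, Theorem 3 and §5C] -/
theorem GranvilleMollin2000_cor1'_thm3_odd_of_eq5_5' (h55 : GranvilleMollin2000_eq5_5')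
    (hHB : GranvilleMollin2000_heathBrownLemma3) : GranvilleMollin2000_cor1'_thm3_odd :=
  GranvilleMollin2000_cor1'_thm3_odd_of_thm1_eq5_5' GranvilleMollin2000_thm1_holds h55 hHB

end Literature.Barriers.Parity
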